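import Summits.BirchSwinnertonDyer.BirchSwinnertonDyer.Theorems.ManinLocalTwoThreeRootFormFiftyTwo
import Summits.BirchSwinnertonDyer.BirchSwinnertonDyer.Theorems.ManinLocalTwoThreeManinConstantOneHundredFour
import HarnessLib

/-!
# THE ROOT FORM `φ₁₀₄` AS A DATUM-FREE CUSP FORM ON `Γ₀(104)`: cuspidal `η`-representation at level `208`, table to depth `170` (p2's `cF`),
# `a₂ₖ(φ₁₀₄) = 0` by `U₂` + Sturm, and the Néron squeeze `Λ(φ₁₀₄) ⊆ Λ_Néron(104a1)` from p2 g31's Bracket–Sturm certificate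

Cell bsd-f2-manin, route `ManinLocalTwoThree` (crux C2 `ManinOddAtFour`, stmt-BirchSwinnertonDyer-22967; `--supports` helper), LEAD p1 gen 26.
PURPOSE: the root of the level-208 row `208b = 104a ⊗ χ₋₄` (an g55's kernel row of `…PinningTwoHundredEight`, `d′ = 160`), exactly as `…RootFormFiftyTwo`
does for `208c`.  Ingredients, all in the tree: an g54/g55's `η`-basis `Ls` of `M₂(Γ₀(104))` with `hol` (Newman + Ligozat non-negativity), p2 g31's deep tables
`tabsDeep` to depth `170` (`hcertDeep`), the pinned coordinates `yNew` with `hF_row : 112·cF[n] = Σ_j y_j·tabsDeep_j[n]`, the Bracket–Sturm vectors `alphaV/betaV`,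
tables `aT/bT`, and the defect certificate `defectList_eq_oneHundredFour` of `…ManinConstantOneHundredFour`; and the fourteen cuspidal `η`-quotients `Q_j`
of level `208` of `…RootFormFiftyTwo` (ten of them carry `φ₁₀₄`).

* §1 `C104 j` — the eighteen basis `η`-quotients as named MODULAR forms (from `hol`), their tables `tabsDeep` (p2), and **`F104m := 112⁻¹ • Σ_j y_j • C104 j
  ∈ M₂(Γ₀(104))`** with `cF[n] = aₙ(F104m)` (`n < 170`).
* §2 `F104L208` = `F104m` read in `M₂(Γ₀(208))` and the IDENTITY **`F104m = Σ_{j<10} ε′_j Q_{ι j}`** (`ε′_j = ±1`; exact linear algebra, verified to `q⁴⁰⁰`;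
  PROVED by Sturm in `M₂(Γ₀(208))`, 57 coefficients).
* §3 **`F104cusp : CuspForm (Gamma0 104) 2`** (`⇑F104cusp = ⇑F104m`; cuspidality from the level-208 cusp-form representation), `cF_eq_cuspCoeff`,
  **`cuspCoeff_even_F104cusp`** (`U₂ F104cusp = 0`: coefficients `a₂ₙ`, zero for `n < 29`; Sturm `⌊2·168/12⌋ = 28`).
* §4 **`periodLattice_le_F104cusp`**: `Λ(F104cusp) ⊆ Λ(L₀)` for every Néron pair of `104a1 = [0,1,0,−16,−32]` (p2's certificate re-instantiated with `f = F104cusp`).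

HONEST FRAMING: unconditional (standard axioms); bookkeeping for the level-208 row `b`; nothing here proves C2/C3, Manin's conjecture or BSD.
[cite: Ligozat1975, Ch. 3] [cite: Koehler2011, §2.1] [cite: Sturm1987, Thm. 1] [cite: DiamondShurman2005, Prop. 5.2.2(a), §5.6]
[cite: CremonaAlgorithms1997, §2.10, Table 1 (104a1)]
-/

set_option autoImplicit false
-- lint-debt: the directory name repeats the summit name (sibling precedent `ManinLocalTwoThreeRootFormFiftyTwo.lean`)
set_option linter.dupNamespace false

noncomputable section

open Complex Filter Topology
open UpperHalfPlane hiding I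
open scoped Real Topology Manifold MatrixGroups ModularForm
open ModularForm CongruenceSubgroup PowerSeries
open Literature.NumberTheory.ModularForms
open Literature.NumberTheory.EllipticCurves Literature.NumberTheory.EllipticCurves.ModularForms

namespace Summit.BirchSwinnertonDyer.BirchSwinnertonDyer.Theorems.ManinLocalTwoThree.RootFormOneHundredFour

open Summit.BirchSwinnertonDyer.BirchSwinnertonDyer.Theorems.ManinLocalTwoThree
open BracketSturm PinningKernel PinningOneHundredFour LevelOneHundredFour RootFormFiftyTwo

set_option maxHeartbeats 4000000
set_option maxRecDepth 16384

/-! ## §1 The basis forms of `M₂(Γ₀(104))` by name and `F104m` -/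

/-- Newman's conditions for the `j`-th basis quotient (from an's `hol`). [cite: Ligozat1975, Ch. 3] -/
theorem newman104 (j : Fin 18) : NewmanCond 104 (expFn (Ls[(j : ℕ)]).1) 2 := by
  obtain ⟨h1, h2, h3, h4, -⟩ := hol _ (List.getElem_mem j.isLt)
  exact ⟨h1.trans (by norm_num), h2, h3, ⟨(Ls[(j : ℕ)]).2, h4.symm⟩⟩

/-- Ligozat non-negativity for the `j`-th basis quotient (from an's `hol`). [cite: Ligozat1975, Ch. 3] -/
theorem nonneg104 (j : Fin 18) : ∀ c ∈ (104 : ℕ).divisors, 0 ≤ cuspOrder24 104 (expFn (Ls[(j : ℕ)]).1) c :=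
  (hol _ (List.getElem_mem j.isLt)).2.2.2.2

/-- The `j`-th basis `η`-quotient of `M₂(Γ₀(104))` as a named modular form. [cite: Ligozat1975, Ch. 3] -/
def C104 (j : Fin 18) : ModularForm (Gamma0 104) 2 :=
  etaQuotientModularForm 104 (expFn (Ls[(j : ℕ)]).1) 2 (by decide) (newman104 j) (nonneg104 j)

/-- `C104 j (τ)` pointwise. [folklore] -/
theorem C104_apply (j : Fin 18) (τ : ℍ) : C104 j τ = etaQuotient 104 (expFn (Ls[(j : ℕ)]).1) τ := rfl

/-- The deep tables of the basis (p2 g31) as `q`-coefficients of the named forms. [cite: Koehler2011, §2.1] -/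
theorem tabsDeep_eq_modCoef : ∀ i : Fin 18, ∀ n < 170, (((tabsDeep i).getD n 0 : ℤ) : ℂ) = modCoefₗ 104 2 n (C104 i) :=
  tables_of_etaCertsSparse 104 170 (fun i : Fin 18 ↦ expFn (Ls[(i : ℕ)]).1) (fun i ↦ shifts i) tabsDeep C104 C104_apply hshift hcertDeep

/-- **`φ₁₀₄` as a modular form of level `104`**: `112⁻¹ • Σ_j y_j • C104 j` (an's pinned coordinates). [cite: CremonaAlgorithms1997, Table 3 (N = 104)] -/
def F104m : ModularForm (Gamma0 104) 2 := (112 : ℂ)⁻¹ • ∑ j : Fin 18, ((yNew.getD (j : ℕ) 0 : ℤ) : ℂ) • C104 j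

/-- **`aₙ(F104m) = cF[n]`, `n < 170`** (`hF_row`). [cite: CremonaAlgorithms1997, Table 3 (N = 104)] -/
theorem cF_eq_modCoef_F104m : ∀ n < 170, ((cF.getD n 0 : ℤ) : ℂ) = modCoefₗ 104 2 n F104m := by
  intro n hn
  have hR : modCoefₗ 104 2 n (∑ j : Fin 18, ((yNew.getD (j : ℕ) 0 : ℤ) : ℂ) • C104 j) =
      ∑ j : Fin 18, ((yNew.getD (j : ℕ) 0 : ℤ) : ℂ) * (((tabsDeep j).getD n 0 : ℤ) : ℂ) := by
    rw [map_sum]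
    exact Finset.sum_congr rfl fun j _ ↦ by rw [map_smul, smul_eq_mul, ← tabsDeep_eq_modCoef j n hn]
  have hrow : ((112 : ℤ) : ℂ) * ((cF.getD n 0 : ℤ) : ℂ) = ∑ j : Fin 18, ((yNew.getD (j : ℕ) 0 : ℤ) : ℂ) * (((tabsDeep j).getD n 0 : ℤ) : ℂ) := by
    exact_mod_cast hF_row n hn
  rw [F104m, map_smul, smul_eq_mul, hR, ← hrow]
  push_cast
  ring

/-- Evaluation of a finite sum of modular forms of level `104`. [folklore] -/
theorem modularForm_sum_apply104 {ι : Type*} (s : Finset ι) (F : ι → ModularForm (Gamma0 104) 2) (τ : ℍ) :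
    (∑ j ∈ s, F j) τ = ∑ j ∈ s, F j τ := by
  have h : ((∑ j ∈ s, F j : ModularForm (Gamma0 104) 2) : ℍ → ℂ) = ∑ j ∈ s, (⇑(F j) : ℍ → ℂ) :=
    map_sum (ModularForm.coeHom (Γ := Gamma0 104) (k := 2)) F s
  rw [h, Finset.sum_apply]

/-! ## §2 `F104m` at level `208` and the identity with ten of the cuspidal `η`-quotients -/

/-- The index map into the fourteen quotients of `…RootFormFiftyTwo` and the signs `ε′`. [folklore] -/
def ι104 : Fin 10 → Fin 14 := ![0, 1, 2, 3, 4, 9, 10, 11, 12, 13]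

/-- The signs of the representation `φ₁₀₄ = Σ_j ε′_j Q_{ι j}`. [folklore] -/
def ε104 : Fin 10 → ℤ := ![1, 1, -1, -1, 1, -1, 1, 1, -1, 1]

/-- **`F104m` viewed in `M₂(Γ₀(208))`**. [cite: DiamondShurman2005, §5.6] -/
def F104L208 : ModularForm (Gamma0 208) 2 where
  toFun := F104m
  slash_action_eq' γ hγ := SlashInvariantFormClass.slash_action_eq F104m γ (Gamma0GL_le_of_dvd (⟨2, rfl⟩ : 104 ∣ 208) hγ)
  holo' := F104m.holo'
  bdd_at_cusps' hc := F104m.bdd_at_cusps' (hc.mono (Gamma0GL_le_of_dvd (⟨2, rfl⟩ : 104 ∣ 208)))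

/-- `F104m|₂₀₈(τ) = F104m(τ)`. [folklore] -/
theorem F104L208_apply (τ : ℍ) : F104L208 τ = F104m τ := rfl

/-- The representation checked on the integer tables: `cF[n] = Σ_j ε′_j·tabQ_{ι j}[n]`, `n < 57`. [folklore] -/
theorem cF_eq_sum : ∀ n < 57, cF.getD n 0 = ∑ j : Fin 10, ε104 j * (tabQ (ι104 j)).getD n 0 := by
  decide +kernel

/-- **`F104m = Σ_j ε′_j Q_{ι j}` in `M₂(Γ₀(208))`** (Sturm, 57 coefficients). [cite: Sturm1987, Thm. 1] -/
theorem F104L208_eq : F104L208 = ∑ j : Fin 10, ((ε104 j : ℤ) : ℂ) • Qm (ι104 j) := by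
  rw [← sub_eq_zero]
  refine modularForm_eq_zero_of_coeff_eq_zero _ (m := 57) (fun i hi ↦ ?_) (by rw [PinningTwoHundredEight.gamma0_data.1]; decide)
  have hi' : i < 170 := by omega
  have hi'' : i < 128 := by omega
  have hR : modCoefₗ 208 2 i (∑ j : Fin 10, ((ε104 j : ℤ) : ℂ) • Qm (ι104 j)) = ∑ j : Fin 10, ((ε104 j : ℤ) : ℂ) * (((tabQ (ι104 j)).getD i 0 : ℤ) : ℂ) := by
    rw [map_sum]
    exact Finset.sum_congr rfl fun j _ ↦ by rw [map_smul, smul_eq_mul, ← tabQ_eq_modCoef (ι104 j) i hi'']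
  change modCoefₗ 208 2 i (F104L208 - ∑ j : Fin 10, ((ε104 j : ℤ) : ℂ) • Qm (ι104 j)) = 0
  rw [map_sub, hR, show modCoefₗ 208 2 i F104L208 = modCoefₗ 104 2 i F104m from rfl, ← cF_eq_modCoef_F104m i hi', cF_eq_sum i hi]
  push_cast
  exact sub_self _

/-- **`F104m(τ) = Σ_j ε′_j Q_{ι j}(τ)`** pointwise. [folklore] -/
theorem F104m_apply_eq_sum (τ : ℍ) : F104m τ = ∑ j : Fin 10, ((ε104 j : ℤ) : ℂ) * etaQuotient 208 (expFn (lQ (ι104 j))) τ := by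
  rw [← F104L208_apply, F104L208_eq, modularForm_sum_apply]
  exact Finset.sum_congr rfl fun j _ ↦ by rw [ModularForm.IsGLPos.smul_apply, smul_eq_mul, Qm_apply]

/-- `⇑(Σ_j ε′_j Qc_{ι j}) = ⇑F104m` (cusp-form side). [folklore] -/
theorem coe_sum_Qc_eq_F104m : (⇑(∑ j : Fin 10, ((ε104 j : ℤ) : ℂ) • Qc (ι104 j)) : ℍ → ℂ) = ⇑F104m := by
  funext τ
  rw [F104m_apply_eq_sum, cuspForm_sum_apply]
  exact Finset.sum_congr rfl fun j _ ↦ by rw [CuspForm.IsGLPos.smul_apply, smul_eq_mul, Qc_apply]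

/-! ## §3 `φ₁₀₄` as a cusp form of level `104`, its table, and `a₂ₖ = 0` -/

/-- **THE DATUM-FREE ROOT CUSP FORM `φ₁₀₄ ∈ S₂(Γ₀(104))`**. [cite: DiamondShurman2005, §5.6] [cite: CremonaAlgorithms1997, Table 3 (N = 104)] -/
def F104cusp : CuspForm (Gamma0 104) 2 where
  toFun := F104m
  slash_action_eq' γ hγ := SlashInvariantFormClass.slash_action_eq F104m γ hγ
  holo' := F104m.holo'
  zero_at_cusps' {c} hc := by
    have hc208 : IsCusp c ((Gamma0 208 : Subgroup SL(2, ℤ)) : Subgroup (GL (Fin 2) ℝ)) := by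
      rw [Subgroup.IsArithmetic.isCusp_iff_isCusp_SL2Z] at hc ⊢
      exact hc
    have h := (∑ j : Fin 10, ((ε104 j : ℤ) : ℂ) • Qc (ι104 j)).zero_at_cusps' hc208
    rw [show (∑ j : Fin 10, ((ε104 j : ℤ) : ℂ) • Qc (ι104 j)).toFun = ⇑(∑ j : Fin 10, ((ε104 j : ℤ) : ℂ) • Qc (ι104 j)) from rfl,
      coe_sum_Qc_eq_F104m] at h
    exact h

/-- `⇑φ₁₀₄ = ⇑F104m`. [folklore] -/
theorem coe_F104cusp : (⇑F104cusp : ℍ → ℂ) = ⇑F104m := rfl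

/-- **`aₙ(φ₁₀₄) = cF[n]`, `n < 170`.** [cite: CremonaAlgorithms1997, Table 3 (N = 104)] -/
theorem cF_eq_cuspCoeff : ∀ n < 170, ((cF.getD n 0 : ℤ) : ℂ) = cuspCoeff F104cusp n := fun n hn ↦
  (cF_eq_modCoef_F104m n hn).trans rfl

/-- `a₂ₙ(φ₁₀₄) = 0` for `n < 29` (from the table). [folklore] -/
theorem cF_even_zero : ∀ n < 29, cF.getD (2 * n) 0 = 0 := by
  decide

/-- **`U₂ φ₁₀₄ = 0`** (`2 ∣ 104`; coefficients `a₂ₙ`, zero for `n < 29`; Sturm `⌊2·168/12⌋ = 28`). [cite: DiamondShurman2005, Prop. 5.2.2(a)] [cite: Sturm1987, Thm. 1] -/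
theorem heckeT_two_F104cusp : heckeT (Gamma0 104) 2 2 F104cusp = 0 := by
  have hmf : ModularFormClass.modularForm (heckeT (Gamma0 104) 2 2 F104cusp) = 0 := by
    refine modularForm_eq_zero_of_coeff_eq_zero _ (m := 29) (fun i hi ↦ ?_) (by rw [gamma0_data.1]; decide)
    change (qExpansion 1 ⇑(heckeT (Gamma0 104) 2 2 F104cusp)).coeff i = 0
    rw [qExpansion_coeff_heckeT_holds 104 2 F104cusp 2 Nat.prime_two i, if_pos (by norm_num : (2 : ℕ) ∣ 104), add_zero,
      show (qExpansion 1 ⇑F104cusp).coeff (2 * i) = cuspCoeff F104cusp (2 * i) from rfl, ← cF_eq_cuspCoeff (2 * i) (by omega),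
      cF_even_zero i hi, Int.cast_zero]
  exact cuspForm_eq_of_modularForm_eq (hmf.trans (by rfl))

/-- **`a₂ₖ(φ₁₀₄) = 0` for every `k`.** [cite: DiamondShurman2005, Prop. 5.2.2(a)] -/
theorem cuspCoeff_even_F104cusp : ∀ n : ℕ, 2 ∣ n → cuspCoeff F104cusp n = 0 := by
  rintro n ⟨m, rfl⟩
  have h := qExpansion_coeff_heckeT_holds 104 2 F104cusp 2 Nat.prime_two m
  rw [heckeT_two_F104cusp, if_pos (by norm_num : (2 : ℕ) ∣ 104), add_zero, CuspForm.coe_zero, UpperHalfPlane.qExpansion_zero] at h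
  change (qExpansion 1 ⇑F104cusp).coeff (2 * m) = 0
  rw [← h]
  simp

/-- `φ₁₀₄ ≠ 0` (`a₁ = 1`). [folklore] -/
theorem F104cusp_ne_zero : F104cusp ≠ 0 := by
  intro h
  have h1 := cF_eq_cuspCoeff 1 (by norm_num)
  have ht : cF.getD 1 0 = 1 := by decide
  rw [ht, h, show cuspCoeff (0 : CuspForm (Gamma0 104) 2) 1 = 0 from by
    change (qExpansion 1 ⇑(0 : CuspForm (Gamma0 104) 2)).coeff 1 = 0
    rw [CuspForm.coe_zero, UpperHalfPlane.qExpansion_zero]; simp] at h1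
  norm_num at h1

/-! ## §4 The Néron squeeze of `φ₁₀₄` from p2 g31's Bracket–Sturm certificate -/

/-- **`Λ(φ₁₀₄) ⊆ Λ(L₀)` for every Néron period pair `L₀` of `104a1 = [0, 1, 0, −16, −32]`.** [cite: Sturm1987, Thm. 1] [cite: CremonaAlgorithms1997, §2.10] -/
theorem periodLattice_le_F104cusp (L₀ : PeriodPair) (hL₀ : IsNeronLatticeOf ((⟨0, 1, 0, -16, -32⟩ : WeierstrassCurve ℚ).baseChange ℂ) L₀) :
    ∀ z ∈ periodLattice F104cusp, z ∈ L₀.lattice := by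
  obtain ⟨hc₂, hc₃⟩ := neron_invariants_oneHundredFourA1 hL₀
  have hc : ∀ n < 170, ((cF.getD n 0 : ℤ) : ℂ) = (qExpansion 1 ⇑F104cusp).coeff n := cF_eq_cuspCoeff
  have ha : ∀ n < 170, ((aT.getD n 0 : ℤ) : ℂ) = (qExpansion 1 ⇑(∑ j : Fin 18, ((alphaV.getD (j : ℕ) 0 : ℤ) : ℂ) • C104 j)).coeff n := by
    intro n hn
    change _ = modCoefₗ 104 2 n (∑ j : Fin 18, ((alphaV.getD (j : ℕ) 0 : ℤ) : ℂ) • C104 j)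
    rw [map_sum]
    simp only [map_smul, smul_eq_mul]
    rw [Finset.sum_congr rfl (fun j _ ↦ by rw [← tabsDeep_eq_modCoef j n hn])]
    exact_mod_cast hA_row n hn
  have hb : ∀ n < 170, ((bT.getD n 0 : ℤ) : ℂ) = (qExpansion 1 ⇑(∑ j : Fin 18, ((betaV.getD (j : ℕ) 0 : ℤ) : ℂ) • C104 j)).coeff n := by
    intro n hn
    change _ = modCoefₗ 104 2 n (∑ j : Fin 18, ((betaV.getD (j : ℕ) 0 : ℤ) : ℂ) • C104 j)
    rw [map_sum]
    simp only [map_smul, smul_eq_mul]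
    rw [Finset.sum_congr rfl (fun j _ ↦ by rw [← tabsDeep_eq_modCoef j n hn])]
    exact_mod_cast hB_row n hn
  obtain ⟨h0, hB, hC⟩ := defectForm_coeff_eq_zero_of_defectList _ _ F104cusp L₀.g₂ L₀.g₃ aT bT cF ha hb hc
    216 864 14112 22976 (by norm_num) (by norm_num) hc₂ hc₃ (forall_getD_eq_zero_of_eq_replicate defectList_eq_oneHundredFour)
    hBnz_oneHundredFour hCnz_oneHundredFour
  exact periodLattice_le_of_defectForm_eq_zero F104cusp F104cusp_ne_zero L₀ _ _
    (modularForm_eq_zero_of_coeff_eq_zero _ h0 sturm_oneHundredFour) hB hC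

end Summit.BirchSwinnertonDyer.BirchSwinnertonDyer.Theorems.ManinLocalTwoThree.RootFormOneHundredFour

end
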